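import Literature.Geometry.Riemannian.BishopGromovVolumeComparison
import HarnessLib

/-!
# The cut locus has measure zero; integration over `M` through `exp_p` on the injectivity domain

Let `(M, g)` be a connected Riemannian `m`-manifold, `m ≥ 1`, modelled on
`ℝᵐ = EuclideanSpace ℝ (Fin m)`, whose closed distance balls are compact (so its Levi-Civita
connection is complete). We PROVE the measure-theoretic half of Lee 2018, Thm. 10.34 — part (a)
"The cut locus of `p` is a closed subset of `M` of measure zero" (the measure-zero statement; the
tree's `ExponentialMap.lean` vendors (b), (c) and records (a) as not vendored) — together with its
working form, integration over `M` in geodesic coordinates at `p` (Chavel 2006, §III.3,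
Thm. III.3.1 ff.: "`∫_M f dV = ∫_{𝖣_p} f(exp ξ) … dξ`", the domain `𝖣_p ⊆ T_pM` inside the
tangent cut locus):

* `lintegral_image_eq_lintegral_jacobian_mul` — **the area formula for functions**: for a `C¹` map
  `F : ℝᵐ → M` injective on a measurable `S` and a measurable `G : M → [0, ∞]`,
  `∫⁻_{F '' S} G dVol_g = ∫⁻_S 𝒥_F(u) G(F u) du` (from the tree's set version
  `riemVolume_image_eq_lintegral_jacobian`, the two measures `Vol_g|_{F(S)}` and
  `F_*(𝒥_F du|_S)` agreeing on measurable sets);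
* `exists_framing_isometry` — a linear isometry `T : ℝᵐ ≃ (T_pM, g_p)`;
* `riemVolume_compl_image_injectivityDomain_eq_zero` — **`Vol_g(M ∖ exp_p(ID(p))) = 0`**: by
  Hopf–Rinow every point is `exp_p(v)` with `γ_v|[0,1]` minimizing; in polar coordinates
  `v = t ξ` (`setLIntegral_eq_lintegral_sphere_radial`) the minimizing directions not in the
  injectivity domain meet each ray in at most the cut time, a Lebesgue-null set, so by the
  inequality half of the area formula (`riemVolume_image_le_lintegral_jacobian`) their image is
  `Vol_g`-null;
* `riemVolume_geodesicCutLocus_eq_zero` — **Lee 2018, Thm. 10.34 (a), measure part: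
  `Vol_g(Cut(p)) = 0`** (`Cut(p) = exp_p(TCL(p)) ⊆ M ∖ exp_p(ID(p))`,
  `image_injectivityDomain_subset_compl_geodesicCutLocus`);
* `lintegral_riemVolume_eq_lintegral_injectivityDomain` — **integration in geodesic coordinates**:
  for every linear isometry `T : ℝᵐ ≃ T_pM` and measurable `G : M → [0, ∞]`,
  `∫⁻_M G dVol_g = ∫⁻_{T⁻¹ ID(p)} 𝒥(v) G(exp_p(T v)) dv`, `𝒥` the Gram–Jacobian of `exp_p ∘ T`
  (`exp_p` is injective on `ID(p)`, `injOn_riemannianExpMap_injectivityDomain`, and misses only a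
  null set); polar coordinates in `ℝᵐ` (`setLIntegral_eq_lintegral_sphere_radial`) then give
  Chavel's `∫_M f = ∫_{S_p} ∫_0^{c(ξ)} f(exp tξ) √g(t; ξ) dt dμ_p(ξ)`.

These are the tools by which estimates are integrated along all geodesics from a point (segment
inequalities, Colding 1996 / Cheeger–Colding 1996) in the proof programme of
`Colding1996_volume_ghClose`. No definitions, no named facts (D-0026).

## References

* J. M. Lee, *Introduction to Riemannian Manifolds*, 2nd ed., Springer GTM 176 (2018), Thm. 10.34
  (a). [LeeRiemannianManifolds2018]
* I. Chavel, *Riemannian Geometry: A Modern Introduction*, 2nd ed., CUP 2006, §III.3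
  (Thm. III.3.1, (III.3.5)) and Prop. III.4.1 (read: `lit read
  book:chavel2006-riemannian-geometry-modern-introduction`, PDF pp. 105–106). [Chavel2006]
* H. Federer, *Geometric Measure Theory*, Springer 1969, §3.2.3, §3.2.5 (area formula).
  [Federer1969]
-/

noncomputable section

open Bundle Set Function Filter MeasureTheory Manifold
open scoped Manifold ContDiff Topology ENNReal NNReal

namespace Literature.Geometry.Riemannian

open Lorentzian Lorentzian.PseudoRiemannianMetric

variable {m : ℕ} {M : Type*} [TopologicalSpace M] [T2Space M] [SecondCountableTopology M]
  [ChartedSpace (EuclideanSpace ℝ (Fin m)) M] [IsManifold (𝓡 m) ∞ M] [T3Space M]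
  [MeasurableSpace M] [BorelSpace M]
  (g : PseudoRiemannianMetric (𝓡 m) ∞ (EuclideanSpace ℝ (Fin m)) (TangentSpace (𝓡 m) : M → Type _))

/-! ### §1. The area formula for functions -/

section AreaFormula

/-- **The area formula for functions on an injective `C¹` map into a Riemannian manifold**
(Federer 1969, §3.2.3/§3.2.5; Chavel 2006, §III.3): for a `C¹` map `F : ℝᵐ → M` injective on
the measurable set `S` and a measurable `G : M → [0, ∞]`,
`∫⁻_{F '' S} G dVol_g = ∫⁻_S 𝒥_F(u) · G(F u) du`, `𝒥_F(u) = √det (g_{F u}(dF eᵢ, dF eⱼ))`. Proof: by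
the set version `riemVolume_image_eq_lintegral_jacobian` applied to `S ∩ F⁻¹ A`, the measures
`Vol_g|_{F(S)}` and `F_*(𝒥_F du|_S)` agree on measurable `A`, hence on `∫⁻ G`.
[cite: Federer1969, §3.2.3 and §3.2.5] -/
theorem lintegral_image_eq_lintegral_jacobian_mul (hg : g.IsRiemannian)
    {F : EuclideanSpace ℝ (Fin m) → M} (hF : ContMDiff 𝓘(ℝ, EuclideanSpace ℝ (Fin m)) (𝓡 m) 1 F)
    {S : Set (EuclideanSpace ℝ (Fin m))} (hS : MeasurableSet S) (hinj : InjOn F S)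
    {G : M → ℝ≥0∞} (hG : Measurable G) :
    ∫⁻ x in F '' S, G x ∂g.riemVolume =
      ∫⁻ u in S, ENNReal.ofReal (Real.sqrt (Matrix.det (Matrix.of fun i j : Fin m ↦
        g.val (F u) (mfderiv 𝓘(ℝ, EuclideanSpace ℝ (Fin m)) (𝓡 m) F u (EuclideanSpace.single i (1 : ℝ)))
          (mfderiv 𝓘(ℝ, EuclideanSpace ℝ (Fin m)) (𝓡 m) F u (EuclideanSpace.single j (1 : ℝ)))))) *
        G (F u) := by
  set J : EuclideanSpace ℝ (Fin m) → ℝ := fun u ↦ Real.sqrt (Matrix.det (Matrix.of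
    fun i j : Fin m ↦ g.val (F u)
      (mfderiv 𝓘(ℝ, EuclideanSpace ℝ (Fin m)) (𝓡 m) F u (EuclideanSpace.single i (1 : ℝ)))
      (mfderiv 𝓘(ℝ, EuclideanSpace ℝ (Fin m)) (𝓡 m) F u (EuclideanSpace.single j (1 : ℝ)))))
    with hJ_def
  have hJcont : Continuous J := continuous_sqrt_det_gram_mfderiv g hF
  have hJm : Measurable fun u ↦ ENNReal.ofReal (J u) :=
    ENNReal.measurable_ofReal.comp hJcont.measurable
  have hFm : Measurable F := hF.continuous.measurable
  set ν : Measure (EuclideanSpace ℝ (Fin m)) :=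
    ((volume : Measure (EuclideanSpace ℝ (Fin m))).restrict S).withDensity
      fun u ↦ ENNReal.ofReal (J u) with hν_def
  -- the two measures `Vol|_{F(S)}` and `F_*(J du|_S)` agree
  have hμ : g.riemVolume.restrict (F '' S) = Measure.map F ν := by
    refine Measure.ext fun A hA ↦ ?_
    rw [Measure.restrict_apply hA, Measure.map_apply hFm hA, hν_def,
      withDensity_apply _ (hA.preimage hFm), Measure.restrict_restrict (hA.preimage hFm),
      inter_comm A (F '' S), ← image_inter_preimage F S A, inter_comm (F ⁻¹' A) S]
    exact riemVolume_image_eq_lintegral_jacobian g hg hF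
      (fun u q hq ↦ sqrt_det_gram_mfderiv_eq_chart g hg hF.contMDiffAt q hq)
      (hS.inter (hA.preimage hFm)) (hinj.mono inter_subset_left)
  calc ∫⁻ x in F '' S, G x ∂g.riemVolume = ∫⁻ x, G x ∂(Measure.map F ν) := by rw [← hμ]
    _ = ∫⁻ u, G (F u) ∂ν := lintegral_map hG hFm
    _ = ∫⁻ u in S, ENNReal.ofReal (J u) * G (F u) := by
        rw [hν_def]
        show ∫⁻ u, (G ∘ F) u ∂(((volume : Measure (EuclideanSpace ℝ (Fin m))).restrict S).withDensity
          fun u ↦ ENNReal.ofReal (J u)) = _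
        rw [lintegral_withDensity_eq_lintegral_mul _ hJm (hG.comp hFm)]
        rfl

end AreaFormula

/-! ### §2. Isometric framings of a tangent space -/

section Framing

omit [T2Space M] [SecondCountableTopology M] [T3Space M] [MeasurableSpace M] [BorelSpace M] in
/-- **A linear isometry `ℝᵐ ≃ (T_pM, g_p)`**: for a Riemannian `g` there is a linear
equivalence `T` of `ℝᵐ = T_pM` with `g_p(T v, T v) = ‖v‖²` (a `g_p`-orthonormal basis,
`exists_orthonormal_basis`, framed by `exists_framing_of_orthonormal`). [folklore] -/
theorem exists_framing_isometry (hg : g.IsRiemannian) (p : M) :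
    ∃ T : EuclideanSpace ℝ (Fin m) ≃L[ℝ] EuclideanSpace ℝ (Fin m),
      ∀ v, g.val p (T v) (T v) = ‖v‖ ^ 2 := by
  obtain ⟨e₀, he₀⟩ := g.exists_orthonormal_basis p hg
  have hfin : Module.finrank ℝ (TangentSpace (𝓡 m) p) = m := by
    show Module.finrank ℝ (EuclideanSpace ℝ (Fin m)) = m
    exact finrank_euclideanSpace_fin
  set bx : Module.Basis (Fin m) ℝ (EuclideanSpace ℝ (Fin m)) :=
    (e₀.reindex (finCongr hfin) : Module.Basis (Fin m) ℝ (TangentSpace (𝓡 m) p)) with hbx_def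
  have hbxi : ∀ i, bx i = e₀ ((finCongr hfin).symm i) := fun i ↦
    e₀.reindex_apply (finCongr hfin) i
  have honx : ∀ i j, g.val p (bx i) (bx j) = if i = j then (1 : ℝ) else 0 := by
    intro i j
    rw [hbxi, hbxi, he₀]
    simp only [EmbeddingLike.apply_eq_iff_eq]
  obtain ⟨T, -, hT⟩ := exists_framing_of_orthonormal m (g.val p) bx honx
  exact ⟨T, hT⟩

end Framing

/-! ### §3. Null complement of `exp_p(ID(p))`, null cut locus, integration through `exp_p` -/

section Polar

variable [ConnectedSpace M] [g.HasLeviCivita]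

/-- Core of the section: for a linear isometry `T : ℝᵐ ≃ T_pM` (`g_p(Tv, Tv) = ‖v‖²`) on a
complete connected Riemannian manifold modelled on `ℝᵐ`, `m ≥ 1`: the set `T⁻¹ ID(p)` is
measurable, `exp_p ∘ T` is injective on it with image `exp_p(ID(p))`, and the complement of that
image is `Vol_g`-null (Hopf–Rinow, the inequality half of the area formula, polar coordinates in
`ℝᵐ`, and the cut time being the only parameter on a minimizing ray outside the injectivity
domain). [cite: LeeRiemannianManifolds2018, Thm. 10.34] -/
theorem injectivityDomain_framing_core (hg : g.IsRiemannian) (hm : 1 ≤ m)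
    (hcpl : ∀ (x : M) (r : ℝ≥0), IsCompact {y : M | g.edist hg x y ≤ r}) (p : M)
    (T : EuclideanSpace ℝ (Fin m) ≃L[ℝ] EuclideanSpace ℝ (Fin m))
    (hT : ∀ v, g.val p (T v) (T v) = ‖v‖ ^ 2) :
    MeasurableSet {v : EuclideanSpace ℝ (Fin m) |
        (T v : TangentSpace (𝓡 m) p) ∈ injectivityDomain g hg p} ∧
      InjOn (fun v : EuclideanSpace ℝ (Fin m) ↦ riemannianExpMap g p (T v))
        {v : EuclideanSpace ℝ (Fin m) | (T v : TangentSpace (𝓡 m) p) ∈ injectivityDomain g hg p} ∧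
      (fun v : EuclideanSpace ℝ (Fin m) ↦ riemannianExpMap g p (T v)) ''
          {v : EuclideanSpace ℝ (Fin m) | (T v : TangentSpace (𝓡 m) p) ∈ injectivityDomain g hg p} =
        riemannianExpMap g p '' injectivityDomain g hg p ∧
      g.riemVolume (riemannianExpMap g p '' injectivityDomain g hg p)ᶜ = 0 := by
  obtain ⟨k, rfl⟩ : ∃ k, m = k + 1 := ⟨m - 1, by omega⟩
  -- §3.0 the Levi-Civita connection of the smooth metric is `C¹` and `C^∞`, and complete
  have hk1' : ((1 : ℕ∞) : ℕ∞ω) + 1 ≤ (∞ : ℕ∞ω) := by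
    rw [show ((1 : ℕ∞) : ℕ∞ω) + 1 = 2 by norm_num]
    exact WithTop.coe_le_coe.2 le_top
  haveI : CovariantDerivative.ContMDiffCovariantDerivative g.leviCivita 1 :=
    ⟨g.isLocallyContMDiff_leviCivita_holds 1 hk1' univ isOpen_univ⟩
  haveI : CovariantDerivative.ContMDiffCovariantDerivative g.leviCivita (∞ : ℕ∞ω) :=
    ⟨g.isLocallyContMDiff_leviCivita_holds ⊤ (le_of_eq rfl) univ isOpen_univ⟩
  haveI : Fact (1 ≤ (∞ : ℕ∞ω)) := ⟨by exact_mod_cast le_top⟩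
  have hc : IsGeodesicallyComplete g.leviCivita :=
    isGeodesicallyComplete_of_isCompact_closedBall hg hcpl
  -- §3.1 the framing
  have hT_norm : ∀ v, Real.sqrt (g.val p (T v) (T v)) = ‖v‖ := fun v ↦ by
    rw [hT v, Real.sqrt_sq (norm_nonneg _)]
  have hT_surj : ∀ w : TangentSpace (𝓡 (k + 1)) p, ∃ v, T v = w := fun w ↦ T.surjective w
  have hT_inj : Injective T := T.injective
  have hmin_congr : ∀ (w w' : EuclideanSpace ℝ (Fin (k + 1))) (b : ℝ), w = w' →
      (IsMinimizingUpTo g hg p w b ↔ IsMinimizingUpTo g hg p w' b) := by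
    intro w w' b h
    subst h
    exact Iff.rfl
  have hTsmul : ∀ (c : ℝ), 0 < c → ∀ (v : EuclideanSpace ℝ (Fin (k + 1))) (b : ℝ),
      (IsMinimizingUpTo g hg p (T (c • v)) b ↔ IsMinimizingUpTo g hg p (T v) (c * b)) := by
    intro c hc0 v b
    exact (hmin_congr _ _ b (map_smul T c v)).trans
      (isMinimizingUpTo_smul_iff hg hc p (T v) hc0 b)
  -- §3.2 `F = exp_p ∘ T`, its Gram–Jacobian `J`
  set F : EuclideanSpace ℝ (Fin (k + 1)) → M := fun v ↦ riemannianExpMap g p (T v) with hF_def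
  have hexp : ContMDiff 𝓘(ℝ, EuclideanSpace ℝ (Fin (k + 1))) (𝓡 (k + 1)) 1
      (fun u : EuclideanSpace ℝ (Fin (k + 1)) ↦ riemannianExpMap g p u) :=
    (contMDiff_riemannianExpMap g le_rfl hc p).of_le (WithTop.coe_le_coe.mpr le_top)
  have hF1 : ContMDiff 𝓘(ℝ, EuclideanSpace ℝ (Fin (k + 1))) (𝓡 (k + 1)) 1 F :=
    hexp.comp (T : EuclideanSpace ℝ (Fin (k + 1)) →L[ℝ] EuclideanSpace ℝ (Fin (k + 1))).contMDiff
  set J : EuclideanSpace ℝ (Fin (k + 1)) → ℝ := fun v ↦ Real.sqrt (Matrix.det (Matrix.of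
    fun i j : Fin (k + 1) ↦ g.val (F v)
      (mfderiv 𝓘(ℝ, EuclideanSpace ℝ (Fin (k + 1))) (𝓡 (k + 1)) F v (EuclideanSpace.single i (1 : ℝ)))
      (mfderiv 𝓘(ℝ, EuclideanSpace ℝ (Fin (k + 1))) (𝓡 (k + 1)) F v (EuclideanSpace.single j (1 : ℝ)))))
    with hJ_def
  have hJcont : Continuous J := continuous_sqrt_det_gram_mfderiv g hF1
  have hJm : Measurable fun v ↦ ENNReal.ofReal (J v) :=
    ENNReal.measurable_ofReal.comp hJcont.measurable
  -- §3.3 the minimizing directions `U` cover `M` (Hopf–Rinow)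
  set U : Set (EuclideanSpace ℝ (Fin (k + 1))) := {v | IsMinimizingUpTo g hg p (T v) 1} with hU_def
  have hUm : MeasurableSet U :=
    ((isClosed_setOf_isMinimizingUpTo g le_rfl hg hc p).preimage
      ((T : EuclideanSpace ℝ (Fin (k + 1)) →L[ℝ] EuclideanSpace ℝ (Fin (k + 1))).continuous.prodMk
        continuous_const :
        Continuous fun v : EuclideanSpace ℝ (Fin (k + 1)) ↦ (T v, (1 : ℝ)))).measurableSet
  have hcoverU : ∀ y : M, ∃ v ∈ U, F v = y := by
    intro y
    obtain ⟨w, hw, hwy⟩ := exists_isMinimizingUpTo_of_isGeodesicallyComplete g le_rfl hg hc p y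
    obtain ⟨v, hv⟩ := hT_surj w
    refine ⟨v, by rw [hU_def, mem_setOf_eq, hv]; exact hw, ?_⟩
    rw [hF_def]
    simp only
    rw [hv]
    exact hwy
  -- §3.4 the injectivity domain in the framing, through the rationals (measurability)
  set L : Set (EuclideanSpace ℝ (Fin (k + 1))) :=
    {v | ∃ q : ℚ, (1 : ℝ) < q ∧ IsMinimizingUpTo g hg p (T v) q} with hL_def
  have hLm : MeasurableSet L := by
    have hq_closed : ∀ q : ℚ, IsClosed {v : EuclideanSpace ℝ (Fin (k + 1)) |
        IsMinimizingUpTo g hg p (T v) q} := fun q ↦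
      (isClosed_setOf_isMinimizingUpTo g le_rfl hg hc p).preimage
        ((T : EuclideanSpace ℝ (Fin (k + 1)) →L[ℝ] EuclideanSpace ℝ (Fin (k + 1))).continuous.prodMk
          continuous_const :
          Continuous fun v : EuclideanSpace ℝ (Fin (k + 1)) ↦ (T v, ((q : ℚ) : ℝ)))
    have heq : L = ⋃ q : ℚ, ({v : EuclideanSpace ℝ (Fin (k + 1)) | (1 : ℝ) < q} ∩
        {v : EuclideanSpace ℝ (Fin (k + 1)) | IsMinimizingUpTo g hg p (T v) q}) := by
      ext v
      simp only [hL_def, mem_setOf_eq, mem_iUnion, mem_inter_iff]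
    rw [heq]
    exact MeasurableSet.iUnion fun q ↦ (MeasurableSet.const _).inter (hq_closed q).measurableSet
  have hLID : ∀ v, v ∈ L ↔ (T v : TangentSpace (𝓡 (k + 1)) p) ∈ injectivityDomain g hg p := by
    intro v
    constructor
    · rintro ⟨q, hq1, hq⟩
      exact ⟨q, hq1, hq⟩
    · rintro ⟨s, hs1, hs⟩
      obtain ⟨q, hq1, hqs⟩ := exists_rat_btwn hs1
      exact ⟨q, hq1, hs.mono hc (zero_le_one.trans hq1.le) hqs.le⟩
  have hLeq : L = {v : EuclideanSpace ℝ (Fin (k + 1)) |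
      (T v : TangentSpace (𝓡 (k + 1)) p) ∈ injectivityDomain g hg p} :=
    Set.ext hLID
  have hLinj : InjOn F L := by
    intro v hv w hw hvw
    exact hT_inj (injOn_riemannianExpMap_injectivityDomain g le_rfl hg hc p ((hLID v).1 hv)
      ((hLID w).1 hw) hvw)
  have hLimage : F '' L = riemannianExpMap g p '' injectivityDomain g hg p := by
    apply subset_antisymm
    · rintro _ ⟨v, hv, rfl⟩
      exact ⟨T v, (hLID v).1 hv, rfl⟩
    · rintro _ ⟨w, hw, rfl⟩
      obtain ⟨v, hv⟩ := hT_surj w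
      refine ⟨v, (hLID v).2 (by rw [hv]; exact hw), ?_⟩
      rw [hF_def]
      simp only
      rw [hv]
  -- §3.5 the complement of `exp_p(ID(p))` lies in `F(U \ L)`, which is null
  have hsub : (riemannianExpMap g p '' injectivityDomain g hg p)ᶜ ⊆ F '' (U \ L) := by
    intro x hx
    obtain ⟨v, hvU, hvx⟩ := hcoverU x
    refine ⟨v, ⟨hvU, fun hvL ↦ hx ?_⟩, hvx⟩
    rw [← hLimage, ← hvx]
    exact mem_image_of_mem F hvL
  have hnull : g.riemVolume (F '' (U \ L)) = 0 := by
    refine le_antisymm ?_ zero_le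
    calc g.riemVolume (F '' (U \ L))
        ≤ ∫⁻ v in U \ L, ENNReal.ofReal (J v) :=
          riemVolume_image_le_lintegral_jacobian g hg hF1
            (fun u q hq ↦ sqrt_det_gram_mfderiv_eq_chart g hg hF1.contMDiffAt q hq) (hUm.diff hLm)
      _ = ∫⁻ ξ : Metric.sphere (0 : EuclideanSpace ℝ (Fin (k + 1))) 1, (∫⁻ t in Ioi (0 : ℝ),
            ENNReal.ofReal (t ^ k) * (U \ L).indicator (fun v ↦ ENNReal.ofReal (J v))
              (t • (ξ : EuclideanSpace ℝ (Fin (k + 1))))) ∂(volume : Measure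
                (EuclideanSpace ℝ (Fin (k + 1)))).toSphere :=
          setLIntegral_eq_lintegral_sphere_radial k hJm (hUm.diff hLm)
      _ = ∫⁻ ξ : Metric.sphere (0 : EuclideanSpace ℝ (Fin (k + 1))) 1, 0 ∂(volume : Measure
                (EuclideanSpace ℝ (Fin (k + 1)))).toSphere := by
          refine lintegral_congr fun ξ ↦ ?_
          have hξ : ‖(ξ : EuclideanSpace ℝ (Fin (k + 1)))‖ = 1 := norm_eq_of_mem_sphere ξ
          -- the cut times of `T ξ` form a subsingleton, a Lebesgue-null set
          set D : Set ℝ := {t | 0 < t ∧ IsMinimizingUpTo g hg p (T ξ) t ∧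
            ∀ s : ℝ, t < s → ¬ IsMinimizingUpTo g hg p (T ξ) s} with hD_def
          have hDsub : D.Subsingleton := by
            intro t₁ ht₁ t₂ ht₂
            by_contra hne
            rcases lt_or_gt_of_ne hne with h | h
            · exact ht₁.2.2 t₂ h ht₂.2.1
            · exact ht₂.2.2 t₁ h ht₁.2.1
          have hD0 : ∀ᵐ t ∂((volume : Measure ℝ).restrict (Ioi 0)), t ∉ D :=
            ae_restrict_of_ae (measure_eq_zero_iff_ae_notMem.1 (hDsub.measure_zero volume))
          rw [← lintegral_zero]
          refine lintegral_congr_ae ?_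
          filter_upwards [ae_restrict_mem measurableSet_Ioi, hD0] with t ht htD
          have ht0 : 0 < t := ht
          have hmemU : t • (ξ : EuclideanSpace ℝ (Fin (k + 1))) ∈ U ↔
              IsMinimizingUpTo g hg p (T ξ) t := by
            simp only [hU_def, mem_setOf_eq, hTsmul t ht0, mul_one]
          have hmemL : t • (ξ : EuclideanSpace ℝ (Fin (k + 1))) ∈ L ↔
              ∃ q : ℚ, (1 : ℝ) < q ∧ IsMinimizingUpTo g hg p (T ξ) (t * q) := by
            simp only [hL_def, mem_setOf_eq, hTsmul t ht0]
          have hnot : t • (ξ : EuclideanSpace ℝ (Fin (k + 1))) ∉ U \ L := by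
            rintro ⟨hU, hL⟩
            refine htD ⟨ht0, hmemU.1 hU, fun s hts hs ↦ hL (hmemL.2 ?_)⟩
            obtain ⟨q, hq1, hqs⟩ := exists_rat_btwn ((one_lt_div ht0).2 hts)
            exact ⟨q, hq1, hs.mono hc (mul_nonneg ht0.le (zero_le_one.trans hq1.le))
              ((lt_div_iff₀' ht0).1 hqs).le⟩
          rw [Set.indicator_of_notMem hnot, mul_zero]
      _ = 0 := lintegral_zero
  have hcompl0 : g.riemVolume (riemannianExpMap g p '' injectivityDomain g hg p)ᶜ = 0 :=
    measure_mono_null hsub hnull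
  refine ⟨hLeq ▸ hLm, ?_, ?_, hcompl0⟩
  · rw [← hLeq]
    exact hLinj
  · rw [← hLeq]
    exact hLimage

/-- **`Vol_g(M ∖ exp_p(ID(p))) = 0`**: on a connected Riemannian `m`-manifold (`m ≥ 1`, modelled
on `ℝᵐ`) with compact closed distance balls, the image of the injectivity domain under `exp_p`
has null complement (Lee 2018, Thm. 10.34: `exp_p(ID(p)) = M ∖ Cut(p)` and `Cut(p)` has measure
zero; Chavel 2006, §III.3). [cite: LeeRiemannianManifolds2018, Thm. 10.34] -/
theorem riemVolume_compl_image_injectivityDomain_eq_zero (hg : g.IsRiemannian) (hm : 1 ≤ m)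
    (hcpl : ∀ (x : M) (r : ℝ≥0), IsCompact {y : M | g.edist hg x y ≤ r}) (p : M) :
    g.riemVolume (riemannianExpMap g p '' injectivityDomain g hg p)ᶜ = 0 := by
  obtain ⟨T, hT⟩ := exists_framing_isometry g hg p
  exact (injectivityDomain_framing_core g hg hm hcpl p T hT).2.2.2

/-- **The cut locus has measure zero** (Lee 2018, Thm. 10.34 (a): "The cut locus of `p` is a
closed subset of `M` of measure zero" — the measure statement, for Lee's
`Cut(p) = exp_p(TCL(p)) = geodesicCutLocus`): on a connected Riemannian `m`-manifold (`m ≥ 1`,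
modelled on `ℝᵐ`) with compact closed distance balls, `Vol_g(Cut(p)) = 0`, since
`Cut(p) ⊆ M ∖ exp_p(ID(p))` (`image_injectivityDomain_subset_compl_geodesicCutLocus`).
[cite: LeeRiemannianManifolds2018, Thm. 10.34 (a)] -/
theorem riemVolume_geodesicCutLocus_eq_zero (hg : g.IsRiemannian) (hm : 1 ≤ m)
    (hcpl : ∀ (x : M) (r : ℝ≥0), IsCompact {y : M | g.edist hg x y ≤ r}) (p : M) :
    g.riemVolume (geodesicCutLocus g hg p) = 0 := by
  have hk1' : ((1 : ℕ∞) : ℕ∞ω) + 1 ≤ (∞ : ℕ∞ω) := by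
    rw [show ((1 : ℕ∞) : ℕ∞ω) + 1 = 2 by norm_num]
    exact WithTop.coe_le_coe.2 le_top
  haveI : CovariantDerivative.ContMDiffCovariantDerivative g.leviCivita 1 :=
    ⟨g.isLocallyContMDiff_leviCivita_holds 1 hk1' univ isOpen_univ⟩
  have hc : IsGeodesicallyComplete g.leviCivita :=
    isGeodesicallyComplete_of_isCompact_closedBall hg hcpl
  have hsub : geodesicCutLocus g hg p ⊆ (riemannianExpMap g p '' injectivityDomain g hg p)ᶜ :=
    subset_compl_comm.1 (image_injectivityDomain_subset_compl_geodesicCutLocus g le_rfl hg hc p)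
  exact measure_mono_null hsub (riemVolume_compl_image_injectivityDomain_eq_zero g hg hm hcpl p)

/-- **Integration over `M` in geodesic coordinates at `p`** (Chavel 2006, §III.3, Thm. III.3.1:
"`∫_M f dV = ∫_{𝖣_p} f(exp ξ) … dξ`"; Lee 2018, Thm. 10.34): on a connected Riemannian
`m`-manifold (`m ≥ 1`, modelled on `ℝᵐ`) with compact closed distance balls, for every linear
isometry `T : ℝᵐ ≃ (T_pM, g_p)` and measurable `G : M → [0, ∞]`,
`∫⁻_M G dVol_g = ∫⁻_{T⁻¹ ID(p)} 𝒥(v) · G(exp_p(T v)) dv`, `𝒥` the Gram–Jacobian of `exp_p ∘ T` in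
the standard basis (`exp_p` is injective on the injectivity domain with `Vol_g`-null complement of
its image; the area formula for functions). Polar coordinates `v = t ξ` in `ℝᵐ`
(`setLIntegral_eq_lintegral_sphere_radial`) turn the right side into Chavel's
`∫_{S_p} ∫₀^{c(ξ)} G(exp tξ) 𝒥 t^{m-1} dt dμ_p(ξ)`. [cite: Chavel2006, Thm. III.3.1] -/
theorem lintegral_riemVolume_eq_lintegral_injectivityDomain (hg : g.IsRiemannian) (hm : 1 ≤ m)
    (hcpl : ∀ (x : M) (r : ℝ≥0), IsCompact {y : M | g.edist hg x y ≤ r}) (p : M)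
    (T : EuclideanSpace ℝ (Fin m) ≃L[ℝ] EuclideanSpace ℝ (Fin m))
    (hT : ∀ v, g.val p (T v) (T v) = ‖v‖ ^ 2) {G : M → ℝ≥0∞} (hG : Measurable G) :
    ∫⁻ x, G x ∂g.riemVolume =
      ∫⁻ v in {v : EuclideanSpace ℝ (Fin m) |
          (T v : TangentSpace (𝓡 m) p) ∈ injectivityDomain g hg p},
        ENNReal.ofReal (Real.sqrt (Matrix.det (Matrix.of fun i j : Fin m ↦
          g.val (riemannianExpMap g p (T v))
            (mfderiv 𝓘(ℝ, EuclideanSpace ℝ (Fin m)) (𝓡 m)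
              (fun v : EuclideanSpace ℝ (Fin m) ↦ riemannianExpMap g p (T v)) v
              (EuclideanSpace.single i (1 : ℝ)))
            (mfderiv 𝓘(ℝ, EuclideanSpace ℝ (Fin m)) (𝓡 m)
              (fun v : EuclideanSpace ℝ (Fin m) ↦ riemannianExpMap g p (T v)) v
              (EuclideanSpace.single j (1 : ℝ)))))) *
          G (riemannianExpMap g p (T v)) := by
  obtain ⟨hLm, hLinj, hLimage, hnull⟩ := injectivityDomain_framing_core g hg hm hcpl p T hT
  have hk1' : ((1 : ℕ∞) : ℕ∞ω) + 1 ≤ (∞ : ℕ∞ω) := by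
    rw [show ((1 : ℕ∞) : ℕ∞ω) + 1 = 2 by norm_num]
    exact WithTop.coe_le_coe.2 le_top
  haveI : CovariantDerivative.ContMDiffCovariantDerivative g.leviCivita 1 :=
    ⟨g.isLocallyContMDiff_leviCivita_holds 1 hk1' univ isOpen_univ⟩
  have hc : IsGeodesicallyComplete g.leviCivita :=
    isGeodesicallyComplete_of_isCompact_closedBall hg hcpl
  have hexp : ContMDiff 𝓘(ℝ, EuclideanSpace ℝ (Fin m)) (𝓡 m) 1
      (fun u : EuclideanSpace ℝ (Fin m) ↦ riemannianExpMap g p u) :=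
    (contMDiff_riemannianExpMap g le_rfl hc p).of_le (WithTop.coe_le_coe.mpr le_top)
  have hF1 : ContMDiff 𝓘(ℝ, EuclideanSpace ℝ (Fin m)) (𝓡 m) 1
      (fun v : EuclideanSpace ℝ (Fin m) ↦ riemannianExpMap g p (T v)) :=
    hexp.comp (T : EuclideanSpace ℝ (Fin m) →L[ℝ] EuclideanSpace ℝ (Fin m)).contMDiff
  have hmeas : MeasurableSet (riemannianExpMap g p '' injectivityDomain g hg p) := by
    rw [← hLimage]
    exact measurableSet_image_of_contMDiff_injOn hF1 hLm hLinj
  rw [← lintegral_add_compl G hmeas, setLIntegral_measure_zero _ G hnull, add_zero, ← hLimage]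
  exact lintegral_image_eq_lintegral_jacobian_mul g hg hF1 hLm hLinj hG

end Polar

end Literature.Geometry.Riemannian

end
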